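import Literature.Analysis.FluidPDE.FlatSwirlGaugeChart
import HarnessLib

/-!
# Time relabelling of kinematic vortex charts: the drift-size defect is NOT a property of the foliation

Companion to `Literature/Analysis/FluidPDE/FlatSwirlGaugeChart.lean` (kinematic vortex charts
`IsVortexChartOn u T x₀ ρ C₀ M α d` and drift-size transport defect `HasDriftSizeDefectOn ν u T x₀ ρ C₁ α d`,
`f = transportDefect ν u α = ∂ₜα + (u·∇)α − νΔα`; the two halves K and D into which route `FlatSwirlGauge` of
`NavierStokesRegularity` cuts its crux `FlatGaugeAtSingularity`, item `stmt-NavierStokesRegularity-1252`). The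
registered line card of that crux states, informally, that D ("SOME chart at the singular point has drift-size
defect") must be EXISTENTIAL in the chart because "the universal version is false by time-dependent
relabelling". This file makes that a theorem, for an arbitrary velocity field `u` and viscosity `ν` (pure
kinematics and calculus — no Navier–Stokes input, nothing assumed):

* `IsVortexChartOn.mono_const`, `IsVortexChartOn.restrict` — chart API (larger constants; smaller cylinder
  with constant `C₀ρ/ρ'`, `0 ≤ C₀`), parallel to `IsFlatSwirlGaugeOn.mono_const/restrict`.
* `IsVortexChartOn.relabel` — TIME RELABELLING: if `(α, d)` is a chart on `Q_ρ(T, x₀)` then so is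
  `(α + h(t), d)` with `h(t) = sin((t − (T − ρ²))⁻¹)` (bounded, smooth on `t > T − ρ²`, with `|h'|` unbounded as
  `t ↓ T − ρ²`): same gradient field slice by slice — hence the same vortex-line foliation, the same
  nondegeneracy and volume data — and momentum bound `M + 1`.
* `IsVortexChartOn.IsVortexChartOn.not_hasDriftSizeDefectOn_relabel` — but if `(α, d)` has drift-size defect on `Q_{ρ'}(T, x₀)` for a chart
  given on a larger cylinder `Q_ρ(T, x₀)` (`ρ' < ρ`), then `(α + h, d)` has drift-size defect for NO constant:
  `f_{α+h} = f_α + h'(t)`; at the times `t_n = (T − ρ'²) + (2πn)⁻¹` one has `|h'(t_n)| = (2πn)²`, the volume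
  clause gives a point `x_n ∈ B_{ρ'}(x₀)` with `d(t_n, x_n) ≥ δ₀` (a fixed `δ₀ > 0`), and `‖∇α‖` is bounded on
  the compact set `[T − ρ'², T − ρ'²/2] × B̄_{ρ'}(x₀)` inside the open cylinder where `α` is `C²`
  (`IsVortexChartOn.IsVortexChartOn.exists_bound_gradient`); so
  `(2πn)² δ₀ ≤ |h'(t_n)| d ≤ |f_{α+h}| d + |f_α| d ≤ ν (C₁' + C₁) ‖∇α‖ ≤ const`, absurd for large `n`.
* `IsVortexChartOn.exists_forall_not_hasDriftSizeDefectOn` — MAIN: from ANY kinematic vortex chart `(α, d)` on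
  `Q_ρ(T, x₀)` one gets, for every `ν`, a kinematic vortex chart `(α', d)` on `Q_{ρ/2}(T, x₀)` with the SAME
  gradient field (`∇α' = ∇α` at all `(t, x)`) and NO drift-size defect for any constant `C₁` (dichotomy: either
  `α` itself already has none on the half cylinder, or it has one and the relabelled `α + h` has none;
  `IsVortexChartOn.IsVortexChartOn.not_hasDriftSizeDefectOn_relabel`).
* `not_forall_isVortexChartOn_exists_hasDriftSizeDefectOn` — hence the UNIVERSAL-in-the-chart strengthening of
  D ("every kinematic vortex chart at `(T, x₀)` has drift-size defect for some `C₁`") is FALSE as soon as one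
  chart exists at `(T, x₀)`, i.e. exactly in the situation produced by stub K. Consequences for the line: D is
  not a property of the foliation `{α(t, ·) = const}` (nor of `∇α`, `d`, `C₀`); any proof of D must CONSTRUCT the
  time-labelling of the leaves (spend the gauge freedom `α ↦ Φ(t, α)`), and no argument insensitive to
  `α ↦ α + h(t)` can prove it.

Only Mathlib and `Literature/Analysis/FluidPDE/FlatSwirlGauge{,Chart}.lean` are used. Deliberately NOT here: any
existence statement for charts (stub K), any Navier–Stokes dynamics.

## References

* G. Koch, N. Nadirashvili, G. Seregin, V. Šverák, *Liouville theorems for the Navier–Stokes equations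
  and applications*, Acta Math. 203 (2009), eq. (1.8) (the exactly-flat model of the objects). [KNSS2009]
-/

noncomputable section

open Set MeasureTheory Metric Function Filter InnerProductSpace
open scoped RealInnerProductSpace ENNReal Topology Real Laplacian

namespace Literature.Analysis.FluidPDE

variable {ν T ρ ρ' C₀ C₁ M : ℝ} {u : ℝ → EuclideanSpace ℝ (Fin 3) → EuclideanSpace ℝ (Fin 3)}
  {x₀ : EuclideanSpace ℝ (Fin 3)} {α : ℝ → EuclideanSpace ℝ (Fin 3) → ℝ}
  {d : ℝ → EuclideanSpace ℝ (Fin 3) → ℝ}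

/-! ### Chart API: constants and restriction -/

/-- **Monotonicity in the constants**: larger `C₀`, `M` are again admissible for a kinematic vortex chart (no
sign condition: `ofReal` and `C₀ ‖∇α‖` are monotone in `C₀`). [folklore] -/
theorem IsVortexChartOn.mono_const (h : IsVortexChartOn u T x₀ ρ C₀ M α d) {C₀' M' : ℝ} (hC : C₀ ≤ C₀')
    (hM : M ≤ M') : IsVortexChartOn u T x₀ ρ C₀' M' α d := by
  obtain ⟨hρ, hρT, hcd, hvol, hpt⟩ := h
  refine ⟨hρ, hρT, hcd, fun t ht δ hδ => (hvol t ht δ hδ).trans (ENNReal.ofReal_le_ofReal ?_),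
    fun t ht x hx => ?_⟩
  · have : 0 ≤ δ ^ 2 * ρ := by positivity
    nlinarith
  · obtain ⟨h1, h2, h3⟩ := hpt t ht x hx
    exact ⟨h1.trans hM, h2, fun hd => (h3 hd).trans (mul_le_mul_of_nonneg_right hC (norm_nonneg _))⟩

/-- **Restriction to a smaller cylinder** (`0 ≤ C₀`, `0 < ρ' ≤ ρ`): the same data on `Q_{ρ'}(T, x₀)` are a
kinematic vortex chart with constant `C₀ρ/ρ'` — the pointwise clauses restrict verbatim, and
`vol({d < δ} ∩ B_{ρ'}) ≤ vol({d < δ} ∩ B_ρ) ≤ C₀δ²ρ = (C₀ρ/ρ')δ²ρ'`. [folklore] -/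
theorem IsVortexChartOn.restrict (h : IsVortexChartOn u T x₀ ρ C₀ M α d) (hC₀ : 0 ≤ C₀) (hρ' : 0 < ρ')
    (hle : ρ' ≤ ρ) : IsVortexChartOn u T x₀ ρ' (C₀ * (ρ / ρ')) M α d := by
  obtain ⟨hρ, hρT, hcd, hvol, hpt⟩ := h
  have hsq : ρ' ^ 2 ≤ ρ ^ 2 := by nlinarith
  have hCle : C₀ ≤ C₀ * (ρ / ρ') := le_mul_of_one_le_right hC₀ ((one_le_div hρ').2 hle)
  have hI : Ioo (T - ρ' ^ 2) T ⊆ Ioo (T - ρ ^ 2) T := Ioo_subset_Ioo_left (by linarith)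
  have hB : ball x₀ ρ' ⊆ ball x₀ ρ := ball_subset_ball hle
  refine ⟨hρ', hsq.trans_lt hρT, hcd.mono (prod_mono hI hB), fun t ht δ hδ => ?_, fun t ht x hx => ?_⟩
  · calc volume ({x | d t x < δ} ∩ ball x₀ ρ')
        ≤ volume ({x | d t x < δ} ∩ ball x₀ ρ) := measure_mono (inter_subset_inter_right _ hB)
      _ ≤ ENNReal.ofReal (C₀ * δ ^ 2 * ρ) := hvol t (hI ht) δ ⟨hδ.1, hδ.2.trans_le hle⟩
      _ = ENNReal.ofReal (C₀ * (ρ / ρ') * δ ^ 2 * ρ') := by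
          congr 1
          field_simp
  · obtain ⟨h1, h2, h3⟩ := hpt t (hI ht) x (hB hx)
    exact ⟨h1, h2, fun hd => (h3 hd).trans (mul_le_mul_of_nonneg_right hCle (norm_nonneg _))⟩

/-! ### Calculus of a time relabelling `α + h(t)` -/

section Calculus

variable {F : Type*} [NormedAddCommGroup F] [NormedSpace ℝ F]

/-- `∇(f + c) = ∇f` pointwise, no differentiability hypothesis (Mathlib `fderiv_add_const`). [folklore] -/
theorem gradient_fun_add_const (f : EuclideanSpace ℝ (Fin 3) → ℝ) (c : ℝ) (x : EuclideanSpace ℝ (Fin 3)) :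
    gradient (fun y => f y + c) x = gradient f x := by
  simp only [gradient, fderiv_add_const]

/-- `Δ(f + c) = Δf` pointwise, no differentiability hypothesis (`Δ = Σᵢ D²(eᵢ, eᵢ)` in an orthonormal frame
and `D(f + c) = Df`). [folklore] -/
theorem laplacian_fun_add_const (f : EuclideanSpace ℝ (Fin 3) → F) (c : F) (x : EuclideanSpace ℝ (Fin 3)) :
    (Δ fun y => f y + c) x = (Δ f) x := by
  have h1 : (fderiv ℝ fun y => f y + c) = fderiv ℝ f := by
    funext y
    exact fderiv_add_const c
  rw [laplacian_eq_iteratedFDeriv_stdOrthonormalBasis, laplacian_eq_iteratedFDeriv_stdOrthonormalBasis]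
  simp only [iteratedFDeriv_two_apply, h1]

/-- The transport defect of a time relabelling `α + h(t)`: `f_{α+h}(t, x) = f_α(t, x) + h'(t)` wherever
`s ↦ α(s, x)` and `h` are differentiable at `t` (`(u·∇)` and `Δ` do not see the spatially constant `h(t)`).
[folklore] -/
theorem transportDefect_add_time (α : ℝ → EuclideanSpace ℝ (Fin 3) → ℝ) (h : ℝ → ℝ) {t : ℝ}
    {x : EuclideanSpace ℝ (Fin 3)} (hα : DifferentiableAt ℝ (fun s => α s x) t)
    (hh : DifferentiableAt ℝ h t) :
    transportDefect ν u (fun s y => α s y + h s) t x = transportDefect ν u α t x + deriv h t := by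
  unfold transportDefect
  show deriv (fun s => α s x + h s) t + fderiv ℝ (fun y => α t y + h t) x (u t x) -
      ν * (Δ fun y => α t y + h t) x =
    deriv (fun s => α s x) t + fderiv ℝ (α t) x (u t x) - ν * (Δ (α t)) x + deriv h t
  rw [fderiv_add_const, laplacian_fun_add_const, deriv_fun_add hα hh]
  ring

end Calculus

/-! ### The relabelling function `h(t) = sin((t − a)⁻¹)` -/

/-- `h(t) = sin((t − a)⁻¹)` is smooth on `t ≠ a` (jointly in `(t, x)`, as needed for the `C²` clause). [folklore] -/
theorem timeRelabel_contDiffOn (a : ℝ) {n : WithTop ℕ∞} :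
    ContDiffOn ℝ n (fun p : ℝ × EuclideanSpace ℝ (Fin 3) => Real.sin ((p.1 - a)⁻¹)) {p | p.1 ≠ a} := by
  refine Real.contDiff_sin.comp_contDiffOn (ContDiffOn.inv ?_ fun p hp => sub_ne_zero.2 hp)
  exact (contDiff_fst.sub contDiff_const).contDiffOn

/-- The derivative of `h(t) = sin((t − a)⁻¹)` at `t ≠ a`: `h'(t) = cos((t − a)⁻¹) · (−1/(t − a)²)`. [folklore] -/
theorem timeRelabel_hasDerivAt (a : ℝ) {t : ℝ} (ht : t ≠ a) :
    HasDerivAt (fun s => Real.sin ((s - a)⁻¹)) (Real.cos ((t - a)⁻¹) * (-1 / (t - a) ^ 2)) t := by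
  have h1 : HasDerivAt (fun s => s - a) 1 t := (hasDerivAt_id t).sub_const a
  have h2 : HasDerivAt (fun s => (s - a)⁻¹) (-1 / (t - a) ^ 2) t := h1.inv (sub_ne_zero.2 ht)
  exact h2.sin

/-- At the times `t_n = a + (n · 2π)⁻¹` (`n ≥ 1`): `|h'(t_n)| = (n · 2π)² ≥ n`. [folklore] -/
theorem timeRelabel_abs_deriv_ge (a : ℝ) {n : ℕ} (hn : 1 ≤ n) :
    (n : ℝ) ≤ |deriv (fun s => Real.sin ((s - a)⁻¹)) (a + ((n : ℝ) * (2 * π))⁻¹)| := by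
  have hπ : 0 < (n : ℝ) * (2 * π) := by positivity
  have hne : a + ((n : ℝ) * (2 * π))⁻¹ ≠ a := by
    intro h
    have : ((n : ℝ) * (2 * π))⁻¹ = 0 := by linarith
    exact (inv_ne_zero hπ.ne') this
  rw [(timeRelabel_hasDerivAt a hne).deriv]
  have hsub : a + ((n : ℝ) * (2 * π))⁻¹ - a = ((n : ℝ) * (2 * π))⁻¹ := by ring
  rw [hsub, inv_inv, Real.cos_nat_mul_two_pi, one_mul, inv_pow, abs_div, abs_neg, abs_one,
    abs_inv, abs_of_pos (by positivity : (0 : ℝ) < ((n : ℝ) * (2 * π)) ^ 2), one_div, inv_inv]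
  have hn' : (1 : ℝ) ≤ n := by exact_mod_cast hn
  have h1 : (1 : ℝ) ≤ (n : ℝ) * (2 * π) := by nlinarith [Real.two_le_pi]
  have h2 : (n : ℝ) ≤ (n : ℝ) * (2 * π) := by nlinarith [Real.two_le_pi]
  have h3 : (n : ℝ) * (2 * π) ≤ ((n : ℝ) * (2 * π)) ^ 2 := by nlinarith
  linarith

/-! ### Time relabelling preserves charts -/

/-- **Time relabelling of a chart.** If `(α, d, C₀, M)` is a kinematic vortex chart for `u` on `Q_ρ(T, x₀)`,
then so is `(α + h, d, C₀, M + 1)` with `h(t) = sin((t − (T − ρ²))⁻¹)`: `h` is bounded by `1` and smooth on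
`t > T − ρ²`, and adding a function of time alone changes neither `∇α` (so neither the first-integral clause
nor chart nondegeneracy) nor `d` (so not the volume clause). [folklore] -/
theorem IsVortexChartOn.relabel (h : IsVortexChartOn u T x₀ ρ C₀ M α d) :
    IsVortexChartOn u T x₀ ρ C₀ (M + 1) (fun t x => α t x + Real.sin ((t - (T - ρ ^ 2))⁻¹)) d := by
  obtain ⟨hρ, hρT, hcd, hvol, hpt⟩ := h
  refine ⟨hρ, hρT, ?_, hvol, fun t ht x hx => ?_⟩
  · have h1 : ContDiffOn ℝ 2 (fun p : ℝ × EuclideanSpace ℝ (Fin 3) => Real.sin ((p.1 - (T - ρ ^ 2))⁻¹))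
        (Ioo (T - ρ ^ 2) T ×ˢ ball x₀ ρ) :=
      (timeRelabel_contDiffOn (T - ρ ^ 2)).mono fun p hp => ne_of_gt hp.1.1
    exact hcd.add h1
  · obtain ⟨h1, h2, h3⟩ := hpt t ht x hx
    refine ⟨?_, ?_, fun hd => ?_⟩
    · calc |α t x + Real.sin ((t - (T - ρ ^ 2))⁻¹)|
          ≤ |α t x| + |Real.sin ((t - (T - ρ ^ 2))⁻¹)| := abs_add_le _ _
        _ ≤ M + 1 := add_le_add h1 (Real.abs_sin_le_one _)
    · rw [gradient_fun_add_const]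
      exact h2
    · rw [gradient_fun_add_const]
      exact h3 hd

/-! ### … but destroys any drift-size defect -/

/-- **A uniform gradient bound near the bottom of a sub-cylinder.** For a chart on `Q_ρ(T, x₀)` and
`0 < ρ' < ρ`, `‖∇α(t, x)‖` is bounded on `[T − ρ'², T − ρ'²/2] × B̄_{ρ'}(x₀)`, a compact subset of the open
cylinder on which `α` is `C²` (continuity of `D(uncurry α)` there; `∇α(t, ·)` is a slice of it). [folklore] -/
theorem IsVortexChartOn.exists_bound_gradient (h : IsVortexChartOn u T x₀ ρ C₀ M α d) (hρ' : 0 < ρ') (hρ'ρ : ρ' < ρ) :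
    ∃ G : ℝ, ∀ t ∈ Icc (T - ρ' ^ 2) (T - ρ' ^ 2 / 2), ∀ x ∈ closedBall x₀ ρ',
      ‖gradient (α t) x‖ ≤ G := by
  have hρ : 0 < ρ := h.1
  set U : Set (ℝ × EuclideanSpace ℝ (Fin 3)) := Ioo (T - ρ ^ 2) T ×ˢ ball x₀ ρ with hU
  have hUo : IsOpen U := isOpen_Ioo.prod isOpen_ball
  have hcd : ContDiffOn ℝ 2 (uncurry α) U := h.2.2.1
  have hcont : ContinuousOn (fderiv ℝ (uncurry α)) U := hcd.continuousOn_fderiv_of_isOpen hUo (by norm_num)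
  set K : Set (ℝ × EuclideanSpace ℝ (Fin 3)) := Icc (T - ρ' ^ 2) (T - ρ' ^ 2 / 2) ×ˢ closedBall x₀ ρ'
    with hK
  have hKc : IsCompact K := isCompact_Icc.prod (isCompact_closedBall x₀ ρ')
  have hsq : ρ' ^ 2 < ρ ^ 2 := by nlinarith
  have hKU : K ⊆ U := prod_mono
    (fun t ht => ⟨by linarith [ht.1], by nlinarith [ht.2]⟩) (closedBall_subset_ball hρ'ρ)
  obtain ⟨G, hG⟩ := hKc.exists_bound_of_continuousOn (hcont.mono hKU)
  refine ⟨G, fun t ht x hx => ?_⟩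
  have hpK : (t, x) ∈ K := mk_mem_prod ht hx
  have hpU : (t, x) ∈ U := hKU hpK
  -- `D(α t)(x) = D(uncurry α)(t, x) ∘ inr`
  have hd1 : HasFDerivAt (uncurry α) (fderiv ℝ (uncurry α) (t, x)) (t, x) :=
    ((hcd.differentiableOn (by norm_num)) _ hpU |>.differentiableAt (hUo.mem_nhds hpU)).hasFDerivAt
  have hd2 : HasFDerivAt (α t)
      ((fderiv ℝ (uncurry α) (t, x)).comp (ContinuousLinearMap.inr ℝ ℝ (EuclideanSpace ℝ (Fin 3)))) x :=
    hd1.comp x (hasFDerivAt_prodMk_right t x)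
  rw [gradient, LinearIsometryEquiv.norm_map, hd2.fderiv]
  calc ‖(fderiv ℝ (uncurry α) (t, x)).comp (ContinuousLinearMap.inr ℝ ℝ (EuclideanSpace ℝ (Fin 3)))‖
      ≤ ‖fderiv ℝ (uncurry α) (t, x)‖ * ‖ContinuousLinearMap.inr ℝ ℝ (EuclideanSpace ℝ (Fin 3))‖ :=
        ContinuousLinearMap.opNorm_comp_le _ _
    _ ≤ ‖fderiv ℝ (uncurry α) (t, x)‖ * 1 :=
        mul_le_mul_of_nonneg_left (ContinuousLinearMap.norm_inr_le_one ℝ ℝ _) (norm_nonneg _)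
    _ ≤ G := by simpa using hG _ hpK

/-- **Relabelling destroys the drift-size defect.** Let `(α, d, C₀, M)` be a kinematic vortex chart for `u` on
`Q_ρ(T, x₀)`, `0 < ρ' < ρ`, and suppose `(α, d)` has drift-size transport defect on `Q_{ρ'}(T, x₀)` with some
constant `C₁` (viscosity `ν`). Then the relabelled momentum `α + h`, `h(t) = sin((t − (T − ρ'²))⁻¹)`, has
drift-size defect on `Q_{ρ'}(T, x₀)` for NO constant: `f_{α+h} = f_α + h'` (`transportDefect_add_time`); at
`t_n = (T − ρ'²) + (2πn)⁻¹` one has `|h'(t_n)| ≥ n`, the volume clause of the chart yields `x_n ∈ B_{ρ'}(x₀)` with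
`d(t_n, x_n) ≥ δ₀ > 0` (`δ₀` independent of `n`), and `‖∇α(t_n, x_n)‖ ≤ G` (`IsVortexChartOn.exists_bound_gradient`); a defect
bound with constant `C₁'` would give `n δ₀ ≤ |h'(t_n)| d ≤ |ν| (|C₁'| + |C₁|) G` for all large `n`. [folklore] -/
theorem IsVortexChartOn.not_hasDriftSizeDefectOn_relabel (h : IsVortexChartOn u T x₀ ρ C₀ M α d) (hρ' : 0 < ρ')
    (hρ'ρ : ρ' < ρ) (hdef : HasDriftSizeDefectOn ν u T x₀ ρ' C₁ α d) (C₁' : ℝ) :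
    ¬ HasDriftSizeDefectOn ν u T x₀ ρ' C₁'
        (fun t x => α t x + Real.sin ((t - (T - ρ' ^ 2))⁻¹)) d := by
  intro hcon
  have hρ : 0 < ρ := h.1
  obtain ⟨G, hG⟩ := h.exists_bound_gradient hρ' hρ'ρ
  -- a depth floor `δ₀`: `vol({d < δ₀} ∩ B_ρ) ≤ ofReal (C₀ δ₀² ρ) < vol (B_{ρ'})`
  have hV : 0 < volume (ball x₀ ρ') := measure_ball_pos volume x₀ hρ'
  have htend : Tendsto (fun δ : ℝ => ENNReal.ofReal (C₀ * δ ^ 2 * ρ)) (𝓝[>] 0) (𝓝 0) := by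
    have hc : Continuous fun δ : ℝ => ENNReal.ofReal (C₀ * δ ^ 2 * ρ) :=
      ENNReal.continuous_ofReal.comp (by fun_prop)
    have := (hc.tendsto 0).mono_left (nhdsWithin_le_nhds (s := Ioi (0 : ℝ)))
    simpa using this
  obtain ⟨δ₀, hδ₀V, hδ₀⟩ := ((htend.eventually (eventually_lt_nhds hV)).and (Ioo_mem_nhdsGT hρ')).exists
  -- the contradiction size
  set R : ℝ := |ν| * (|C₁'| + |C₁|) * |G| with hR
  obtain ⟨n, hn⟩ := exists_nat_gt (max (1 / ρ' ^ 2) (R / δ₀))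
  have hn1 : 1 / ρ' ^ 2 < n := (le_max_left _ _).trans_lt hn
  have hn2 : R / δ₀ < n := (le_max_right _ _).trans_lt hn
  have hρ'2 : 0 < ρ' ^ 2 := by positivity
  have hnpos : (0 : ℝ) < n := lt_trans (by positivity) hn1
  have hn_nat : 1 ≤ n := by exact_mod_cast (show (0 : ℝ) < n from hnpos)
  -- the time `t_n`
  set a : ℝ := T - ρ' ^ 2 with ha
  set tn : ℝ := a + ((n : ℝ) * (2 * π))⁻¹ with htn
  have hπn : 0 < (n : ℝ) * (2 * π) := by positivity
  have hinc : 0 < ((n : ℝ) * (2 * π))⁻¹ := inv_pos.2 hπn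
  have hinc2 : ((n : ℝ) * (2 * π))⁻¹ ≤ ρ' ^ 2 / 2 := by
    rw [inv_le_comm₀ hπn (by positivity)]
    have h1 : 1 / ρ' ^ 2 * (2 * π) < (n : ℝ) * (2 * π) := by nlinarith [Real.two_le_pi]
    have h2 : (ρ' ^ 2 / 2)⁻¹ ≤ 1 / ρ' ^ 2 * (2 * π) := by
      rw [show (ρ' ^ 2 / 2)⁻¹ = 1 / ρ' ^ 2 * 2 by field_simp]
      have : 0 < 1 / ρ' ^ 2 := by positivity
      nlinarith [Real.two_le_pi]
    linarith
  have htn_gt : T - ρ' ^ 2 < tn := by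
    simp only [htn, ha]
    linarith
  have htn_le : tn ≤ T - ρ' ^ 2 / 2 := by
    simp only [htn, ha]
    linarith
  have htnI' : tn ∈ Ioo (T - ρ' ^ 2) T := ⟨htn_gt, by linarith⟩
  have htnIcc : tn ∈ Icc (T - ρ' ^ 2) (T - ρ' ^ 2 / 2) := ⟨htn_gt.le, htn_le⟩
  have hsq : ρ' ^ 2 < ρ ^ 2 := by nlinarith
  have htnI : tn ∈ Ioo (T - ρ ^ 2) T := ⟨by linarith [htnI'.1], htnI'.2⟩
  -- a point `x_n ∈ B_{ρ'}` with `d (t_n, x_n) ≥ δ₀`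
  obtain ⟨xn, hxnB, hxnd⟩ : ∃ x ∈ ball x₀ ρ', δ₀ ≤ d tn x := by
    by_contra hne
    push Not at hne
    have hsub : ball x₀ ρ' ⊆ {x | d tn x < δ₀} ∩ ball x₀ ρ :=
      fun x hx => ⟨hne x hx, ball_subset_ball hρ'ρ.le hx⟩
    have h1 := (measure_mono hsub).trans (h.2.2.2.1 tn htnI δ₀ ⟨hδ₀.1, hδ₀.2.trans hρ'ρ⟩)
    exact (lt_irrefl _) (h1.trans_lt hδ₀V)
  have hdpos : 0 < d tn xn := hδ₀.1.trans_le hxnd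
  -- the two defect bounds at `(t_n, x_n)`
  have h1 := hdef tn htnI' xn hxnB hdpos
  have h2 := hcon tn htnI' xn hxnB hdpos
  -- differentiability of `s ↦ α s x_n` at `t_n` (slice of the jointly `C²` momentum) and of `h`
  have hU : IsOpen (Ioo (T - ρ ^ 2) T ×ˢ ball x₀ ρ) := isOpen_Ioo.prod isOpen_ball
  have hpU : (tn, xn) ∈ Ioo (T - ρ ^ 2) T ×ˢ ball x₀ ρ := mk_mem_prod htnI (ball_subset_ball hρ'ρ.le hxnB)
  have hαt : DifferentiableAt ℝ (fun s => α s xn) tn := by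
    have hd1 : DifferentiableAt ℝ (uncurry α) (tn, xn) :=
      ((h.2.2.1.differentiableOn (by norm_num)) _ hpU).differentiableAt (hU.mem_nhds hpU)
    have hd2 : DifferentiableAt ℝ (fun s : ℝ => (s, xn)) tn :=
      differentiableAt_id.prodMk (differentiableAt_const xn)
    exact hd1.comp tn hd2
  have htna : tn ≠ a := by
    intro heq
    have h0 : ((n : ℝ) * (2 * π))⁻¹ = 0 := by
      have : a + ((n : ℝ) * (2 * π))⁻¹ = a := by
        rw [← htn]
        exact heq
      linarith
    exact (inv_ne_zero hπn.ne') h0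
  have hh : DifferentiableAt ℝ (fun s => Real.sin ((s - a)⁻¹)) tn :=
    (timeRelabel_hasDerivAt a htna).differentiableAt
  rw [transportDefect_add_time α _ hαt hh] at h2
  simp only [gradient_fun_add_const] at h2
  -- `|h'(t_n)| ≥ n`
  have hder : (n : ℝ) ≤ |deriv (fun s => Real.sin ((s - a)⁻¹)) tn| := timeRelabel_abs_deriv_ge a hn_nat
  -- assemble: `n δ₀ ≤ |h'| d ≤ (|f + h'| + |f|) d ≤ ν C₁' ‖∇α‖ + ν C₁ ‖∇α‖ ≤ R`
  have hgrad : ‖gradient (α tn) xn‖ ≤ |G| :=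
    (hG tn htnIcc xn (ball_subset_closedBall hxnB)).trans (le_abs_self G)
  set f := transportDefect ν u α tn xn with hf
  set h' := deriv (fun s => Real.sin ((s - a)⁻¹)) tn with hh'
  have hgn : 0 ≤ ‖gradient (α tn) xn‖ := norm_nonneg _
  have hkey : |h'| * d tn xn ≤ R := by
    have e1 : |h'| ≤ |f + h'| + |f| := by
      have := abs_sub (f + h') f
      simp only [add_sub_cancel_left] at this
      linarith [abs_sub_comm (f + h') f]
    have e2 : |h'| * d tn xn ≤ |f + h'| * d tn xn + |f| * d tn xn := by nlinarith
    have e3 : ν * C₁' * ‖gradient (α tn) xn‖ ≤ |ν| * |C₁'| * |G| := by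
      calc ν * C₁' * ‖gradient (α tn) xn‖ ≤ |ν * C₁'| * ‖gradient (α tn) xn‖ :=
            mul_le_mul_of_nonneg_right (le_abs_self _) hgn
        _ ≤ |ν * C₁'| * |G| := mul_le_mul_of_nonneg_left hgrad (abs_nonneg _)
        _ = |ν| * |C₁'| * |G| := by rw [abs_mul]
    have e4 : ν * C₁ * ‖gradient (α tn) xn‖ ≤ |ν| * |C₁| * |G| := by
      calc ν * C₁ * ‖gradient (α tn) xn‖ ≤ |ν * C₁| * ‖gradient (α tn) xn‖ :=
            mul_le_mul_of_nonneg_right (le_abs_self _) hgn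
        _ ≤ |ν * C₁| * |G| := mul_le_mul_of_nonneg_left hgrad (abs_nonneg _)
        _ = |ν| * |C₁| * |G| := by rw [abs_mul]
    have e5 : |f + h'| * d tn xn + |f| * d tn xn ≤ R := by
      rw [hR]
      linarith [h1, h2, e3, e4]
    linarith
  have hlow : (n : ℝ) * δ₀ ≤ |h'| * d tn xn := by
    have := mul_le_mul hder hxnd hδ₀.1.le (abs_nonneg _)
    linarith
  have hRn : R < n * δ₀ := by rwa [div_lt_iff₀ hδ₀.1] at hn2
  linarith

/-! ### Main results -/

/-- **Gauge non-rigidity of the drift-size defect.** From ANY kinematic vortex chart `(α, d, C₀, M)` for `u` on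
`Q_ρ(T, x₀)` and for every viscosity `ν` one obtains a kinematic vortex chart `(α', d)` on the half cylinder
`Q_{ρ/2}(T, x₀)` (constants `2 max C₀ 0`, `M + 1`) with the SAME gradient field — `∇α'(t, ·) = ∇α(t, ·)` for all
`(t, x)`, so the same vortex-line foliation, nondegeneracy and depth — and NO drift-size transport defect for any
constant `C₁`. Dichotomy: either `α` itself has no drift-size defect on the half cylinder (take `α' = α`), or it
has one, and then the time relabelling `α' = α + sin((t − (T − ρ²/4))⁻¹)` has none
(`IsVortexChartOn.not_hasDriftSizeDefectOn_relabel`). [folklore] -/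
theorem IsVortexChartOn.exists_forall_not_hasDriftSizeDefectOn (h : IsVortexChartOn u T x₀ ρ C₀ M α d)
    (ν : ℝ) :
    ∃ (C₀' M' : ℝ) (α' : ℝ → EuclideanSpace ℝ (Fin 3) → ℝ),
      IsVortexChartOn u T x₀ (ρ / 2) C₀' M' α' d ∧
      (∀ t x, gradient (α' t) x = gradient (α t) x) ∧
      ∀ C₁ : ℝ, ¬ HasDriftSizeDefectOn ν u T x₀ (ρ / 2) C₁ α' d := by
  have hρ : 0 < ρ := h.1
  have hρ' : 0 < ρ / 2 := by positivity
  have hρ'ρ : ρ / 2 < ρ := by linarith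
  have h0 : IsVortexChartOn u T x₀ ρ (max C₀ 0) M α d := h.mono_const (le_max_left _ _) le_rfl
  have hres : IsVortexChartOn u T x₀ (ρ / 2) (max C₀ 0 * (ρ / (ρ / 2))) M α d :=
    h0.restrict (le_max_right _ _) hρ' hρ'ρ.le
  by_cases hA : ∃ C₁ : ℝ, HasDriftSizeDefectOn ν u T x₀ (ρ / 2) C₁ α d
  · obtain ⟨C₁, hdef⟩ := hA
    refine ⟨_, M + 1, fun t x => α t x + Real.sin ((t - (T - (ρ / 2) ^ 2))⁻¹),
      hres.relabel, fun t x => gradient_fun_add_const _ _ _, fun C₁' => ?_⟩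
    exact h0.not_hasDriftSizeDefectOn_relabel hρ' hρ'ρ hdef C₁'
  · push Not at hA
    exact ⟨_, M, α, hres, fun _ _ => rfl, hA⟩

/-- **The universal-in-the-chart strengthening of stub D is false whenever a chart exists.** If `u` admits
SOME kinematic vortex chart at `(T, x₀)` (the conclusion of stub K of the registered line, at this point), then
for every `ν` it is NOT the case that every kinematic vortex chart at `(T, x₀)` has drift-size transport defect
for some constant. So D (`stub_driftSizeRegauge`: SOME chart at the singular point has drift-size defect) is
irreducibly existential in the chart: it is not a property of the foliation by vortex surfaces `{α = const}`,
and any proof must construct the time-labelling `α ↦ Φ(t, α)` of the leaves. [folklore] -/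
theorem not_forall_isVortexChartOn_exists_hasDriftSizeDefectOn
    (hK : ∃ (ρ C₀ M : ℝ) (α : ℝ → EuclideanSpace ℝ (Fin 3) → ℝ) (d : ℝ → EuclideanSpace ℝ (Fin 3) → ℝ),
      IsVortexChartOn u T x₀ ρ C₀ M α d) (ν : ℝ) :
    ¬ ∀ (ρ C₀ M : ℝ) (α : ℝ → EuclideanSpace ℝ (Fin 3) → ℝ) (d : ℝ → EuclideanSpace ℝ (Fin 3) → ℝ),
        IsVortexChartOn u T x₀ ρ C₀ M α d → ∃ C₁ : ℝ, HasDriftSizeDefectOn ν u T x₀ ρ C₁ α d := by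
  intro hall
  obtain ⟨ρ, C₀, M, α, d, h⟩ := hK
  obtain ⟨C₀', M', α', hchart, -, hno⟩ := h.exists_forall_not_hasDriftSizeDefectOn ν
  obtain ⟨C₁, hC₁⟩ := hall _ _ _ _ _ hchart
  exact hno C₁ hC₁

/-! ### Appended 2026-08-17 (lead c5 of crux `FlatGaugeAtSingularity`): the general re-gauge `α' = Φ(t, α)`

The time relabelling `α + h(t)` above is the special case `Φ(t, a) = a + h(t)` of the gauge freedom that ONE
first integral licenses, `α ↦ Φ(t, α)` with `∂ₐΦ > 0`. The lemmas below make the whole freedom explicit and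
quantitative (pure calculus, pointwise `ContDiffAt` hypotheses, any `u`, any `ν`):
`∇(Φ(t, α)) = ∂ₐΦ ∇α` (`gradient_comp_deriv_of_differentiableAt`, `inner_gradient_regauge` — the first-integral
clause is kept and the nondegeneracy clause rescales by `∂ₐΦ`), `Δ(Φ(t, α)) = ∂ₐₐΦ ‖∇α‖² + ∂ₐΦ Δα`
(`laplacian_comp_deriv_of_contDiffAt`), `∂ₜ(Φ(t, α)) = ∂ₜΦ + ∂ₐΦ ∂ₜα` (`deriv_regauge_time`), hence
`f_{Φ(t,α)} = ∂ₜΦ + ∂ₐΦ f_α − ν ∂ₐₐΦ ‖∇α‖²` (`transportDefect_regauge`): the re-gauged defect differs from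
`∂ₐΦ f_α` only by LEAF-CONSTANT data (functions of `(t, α)`) and the `‖∇α‖²` term. Together with the identity
`⟪curl u, ∇f_α⟫ = 2ν ∇(curl u) : ∇²α` of `FirstIntegralTransportDefect.lean` (the variation of `f_α` ALONG the
vortex lines is not at the gauge's disposal) this is the exact frame of the drift-size stub D. -/

/-! ### Calculus of a general re-gauge `α' = Φ(t, α)` -/

section Regauge

variable {E : Type*} [NormedAddCommGroup E] [InnerProductSpace ℝ E] [FiniteDimensional ℝ E]

/-- **Chain rule for the gradient of a re-gauged scalar**: for `g : E → ℝ` differentiable at `x` and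
`φ : ℝ → ℝ` differentiable at `g x`, `∇(φ ∘ g)(x) = φ'(g x) ∇g(x)`. [folklore] -/
theorem gradient_comp_deriv_of_differentiableAt {g : E → ℝ} {φ : ℝ → ℝ} {x : E} (hg : DifferentiableAt ℝ g x)
    (hφ : DifferentiableAt ℝ φ (g x)) :
    gradient (fun y => φ (g y)) x = deriv φ (g x) • gradient g x := by
  have h := (hφ.hasDerivAt.comp_hasFDerivAt x hg.hasFDerivAt).fderiv
  rw [gradient, gradient, show (fun y => φ (g y)) = φ ∘ g from rfl, h, map_smul]

/-- **Chain rule for the Laplacian of a re-gauged scalar**: for `g : E → ℝ` of class `C²` at `x` and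
`φ : ℝ → ℝ` of class `C²` at `g x`,
`Δ(φ ∘ g)(x) = φ''(g x) ‖∇g(x)‖² + φ'(g x) Δg(x)`. [folklore] -/
theorem laplacian_comp_deriv_of_contDiffAt {g : E → ℝ} {φ : ℝ → ℝ} {x : E} (hg : ContDiffAt ℝ 2 g x)
    (hφ : ContDiffAt ℝ 2 φ (g x)) :
    Δ (fun y => φ (g y)) x = deriv (deriv φ) (g x) * ‖gradient g x‖ ^ 2 + deriv φ (g x) * Δ g x := by
  set b := stdOrthonormalBasis ℝ E
  -- differentiability near `x` / at `x`
  have hgd : ∀ᶠ y in 𝓝 x, DifferentiableAt ℝ g y :=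
    (hg.eventually (by simp)).mono fun y hy => hy.differentiableAt (by simp)
  have hφd' : ∀ᶠ a in 𝓝 (g x), DifferentiableAt ℝ φ a :=
    (hφ.eventually (by simp)).mono fun a ha => ha.differentiableAt (by simp)
  have hφd : ∀ᶠ y in 𝓝 x, DifferentiableAt ℝ φ (g y) :=
    (hg.continuousAt.tendsto).eventually hφd'
  have hDg : DifferentiableAt ℝ (fderiv ℝ g) x :=
    (hg.fderiv_right (m := 1) (by norm_num)).differentiableAt one_ne_zero
  have hDφ : DifferentiableAt ℝ (deriv φ) (g x) := by
    have h1 : ContDiffAt ℝ 1 (deriv φ) (g x) := by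
      have := hφ.fderiv_right (m := 1) (by norm_num)
      have hev : deriv φ = fun a => fderiv ℝ φ a 1 := by funext a; rfl
      rw [hev]; exact this.clm_apply contDiffAt_const
    exact h1.differentiableAt one_ne_zero
  -- first derivative near `x`: `D(φ ∘ g)(y) = φ'(g y) • Dg(y)`
  have h1 : fderiv ℝ (fun y => φ (g y)) =ᶠ[𝓝 x] fun y => deriv φ (g y) • fderiv ℝ g y := by
    filter_upwards [hgd, hφd] with y hgy hφy
    exact (hφy.hasDerivAt.comp_hasFDerivAt y hgy.hasFDerivAt).fderiv
  -- second derivative at `x`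
  have hψ : DifferentiableAt ℝ (fun y => deriv φ (g y)) x := hDφ.comp x (hg.differentiableAt (by simp))
  have hψ' : fderiv ℝ (fun y => deriv φ (g y)) x = deriv (deriv φ) (g x) • fderiv ℝ g x :=
    (hDφ.hasDerivAt.comp_hasFDerivAt x (hg.differentiableAt (by simp)).hasFDerivAt).fderiv
  have h2 : ∀ v w, fderiv ℝ (fderiv ℝ fun y => φ (g y)) x v w =
      deriv φ (g x) * fderiv ℝ (fderiv ℝ g) x v w +
        deriv (deriv φ) (g x) * fderiv ℝ g x v * fderiv ℝ g x w := by
    intro v w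
    rw [h1.fderiv_eq, fderiv_fun_smul hψ hDg, hψ']
    simp only [FunLike.coe_add, Pi.add_apply, FunLike.coe_smul, Pi.smul_apply,
      ContinuousLinearMap.smulRight_apply, smul_eq_mul]
  -- sum over the frame
  have hpar : ∑ i, fderiv ℝ g x (b i) * fderiv ℝ g x (b i) = ‖gradient g x‖ ^ 2 := by
    rw [← b.sum_sq_norm_inner_left (gradient g x)]
    refine Finset.sum_congr rfl fun i _ => ?_
    rw [inner_gradient_left, Real.norm_eq_abs, sq_abs, sq]
  have hsum2 : ∑ i, deriv (deriv φ) (g x) * fderiv ℝ g x (b i) * fderiv ℝ g x (b i) =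
      deriv (deriv φ) (g x) * ‖gradient g x‖ ^ 2 := by
    rw [← hpar, Finset.mul_sum]
    refine Finset.sum_congr rfl fun i _ => ?_
    ring
  rw [laplacian_eq_iteratedFDeriv_orthonormalBasis _ b, laplacian_eq_iteratedFDeriv_orthonormalBasis g b]
  simp only [iteratedFDeriv_two_apply, Matrix.cons_val_zero, Matrix.cons_val_one,
    Matrix.cons_val_fin_one, h2, Finset.sum_add_distrib, ← Finset.mul_sum, hsum2]
  ring

/-- **Chain rule in time for a re-gauge**: for `Φ : ℝ → ℝ → ℝ` jointly differentiable at `(t, a t)`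
and `a : ℝ → ℝ` differentiable at `t`,
`d/ds Φ(s, a s)|ₜ = ∂ₜΦ(t, a t) + ∂ₐΦ(t, a t) · a'(t)` with the partials written as slice derivatives.
[folklore] -/
theorem deriv_regauge_time {Φ : ℝ → ℝ → ℝ} {a : ℝ → ℝ} {t : ℝ}
    (hΦ : DifferentiableAt ℝ (uncurry Φ) (t, a t)) (ha : DifferentiableAt ℝ a t) :
    deriv (fun s => Φ s (a s)) t =
      deriv (fun s => Φ s (a t)) t + deriv (Φ t) (a t) * deriv a t := by
  set L := fderiv ℝ (uncurry Φ) (t, a t) with hL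
  have hW := hΦ.hasFDerivAt
  -- the curve `s ↦ (s, a s)` and the two coordinate lines
  have hc : HasDerivAt (fun s => Φ s (a s)) (L (1, deriv a t)) t := by
    have h := (hW.comp t ((hasDerivAt_id t).prodMk ha.hasDerivAt).hasFDerivAt).hasDerivAt
    simpa [Function.comp_def] using h
  have ht' : HasDerivAt (fun s => Φ s (a t)) (L (1, 0)) t := by
    have h := (hW.comp t (hasFDerivAt_prodMk_left t (a t))).hasDerivAt
    simp only [ContinuousLinearMap.comp_apply, ContinuousLinearMap.inl_apply] at h
    exact h
  have ha' : HasDerivAt (Φ t) (L (0, 1)) (a t) := by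
    have h := (hW.comp (a t) (hasFDerivAt_prodMk_right t (a t))).hasDerivAt
    simp only [ContinuousLinearMap.comp_apply, ContinuousLinearMap.inr_apply] at h
    exact h
  rw [hc.deriv, ht'.deriv, ha'.deriv]
  have hsplit : ((1 : ℝ), deriv a t) = ((1 : ℝ), (0 : ℝ)) + deriv a t • ((0 : ℝ), (1 : ℝ)) := by
    ext <;> simp
  rw [hsplit, map_add, map_smul, smul_eq_mul]
  ring

end Regauge

/-- **The transport defect of a general re-gauge `α' = Φ(t, α)`.** For a momentum `α` with
`s ↦ α(s, x)` differentiable at `t` and `α(t, ·)` of class `C²` at `x`, and a re-gauging function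
`Φ : ℝ → ℝ → ℝ` jointly `C²` at `(t, α(t, x))`:
`f_{Φ(t,α)} = ∂ₜΦ + ∂ₐΦ · f_α − ν ∂ₐₐΦ ‖∇α‖²` at `(t, x)` (all partials of `Φ` at `(t, α(t, x))`).
With `∇(Φ(t, α)) = ∂ₐΦ ∇α` (`gradient_comp_deriv_of_differentiableAt`) this is the whole gauge freedom of a kinematic vortex
chart licensed by ONE first integral: the new defect differs from `∂ₐΦ · f` by data that are
CONSTANT ON THE LEAVES `{α(t, ·) = a}` (functions of `(t, α)`) plus the `‖∇α‖²`-term; the special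
case `Φ(t, a) = a + h(t)` is `transportDefect_add_time`. [folklore] -/
theorem transportDefect_regauge (Φ : ℝ → ℝ → ℝ) (α : ℝ → EuclideanSpace ℝ (Fin 3) → ℝ) {t : ℝ}
    {x : EuclideanSpace ℝ (Fin 3)} (hΦ : ContDiffAt ℝ 2 (uncurry Φ) (t, α t x))
    (hαt : DifferentiableAt ℝ (fun s => α s x) t) (hαx : ContDiffAt ℝ 2 (α t) x) :
    transportDefect ν u (fun s y => Φ s (α s y)) t x =
      deriv (fun s => Φ s (α t x)) t + deriv (Φ t) (α t x) * transportDefect ν u α t x -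
        ν * deriv (deriv (Φ t)) (α t x) * ‖gradient (α t) x‖ ^ 2 := by
  have hφ : ContDiffAt ℝ 2 (Φ t) (α t x) := hΦ.comp (α t x) (contDiffAt_const.prodMk contDiffAt_id)
  have hφd : DifferentiableAt ℝ (Φ t) (α t x) := hφ.differentiableAt (by simp)
  have hαd : DifferentiableAt ℝ (α t) x := hαx.differentiableAt (by simp)
  unfold transportDefect
  show deriv (fun s => Φ s (α s x)) t + fderiv ℝ (fun y => Φ t (α t y)) x (u t x) -
      ν * (Δ fun y => Φ t (α t y)) x =
    deriv (fun s => Φ s (α t x)) t +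
      deriv (Φ t) (α t x) * (deriv (fun s => α s x) t + fderiv ℝ (α t) x (u t x) - ν * (Δ (α t)) x) -
      ν * deriv (deriv (Φ t)) (α t x) * ‖gradient (α t) x‖ ^ 2
  rw [deriv_regauge_time (hΦ.differentiableAt (by simp)) hαt, laplacian_comp_deriv_of_contDiffAt hαx hφ,
    show (fun y => Φ t (α t y)) = Φ t ∘ α t from rfl,
    (hφd.hasDerivAt.comp_hasFDerivAt x hαd.hasFDerivAt).fderiv]
  simp only [FunLike.coe_smul, Pi.smul_apply, smul_eq_mul]
  ring

/-- **Re-gauging a first integral keeps it a first integral** (and rescales the nondegeneracy clause by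
`∂ₐΦ`): `⟪w, ∇(Φ(t, α(t, ·)))(x)⟫ = ∂ₐΦ(t, α(t, x)) ⟪w, ∇α(t, x)⟫`. [folklore] -/
theorem inner_gradient_regauge (Φ : ℝ → ℝ → ℝ) (α : ℝ → EuclideanSpace ℝ (Fin 3) → ℝ) {t : ℝ}
    {x : EuclideanSpace ℝ (Fin 3)} (hΦ : DifferentiableAt ℝ (Φ t) (α t x))
    (hα : DifferentiableAt ℝ (α t) x) (w : EuclideanSpace ℝ (Fin 3)) :
    ⟪w, gradient (fun y => Φ t (α t y)) x⟫ = deriv (Φ t) (α t x) * ⟪w, gradient (α t) x⟫ := by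
  rw [gradient_comp_deriv_of_differentiableAt hα hΦ, inner_smul_right]

end Literature.Analysis.FluidPDE

end
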